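import Summits.Ventures.PercRepro.MSTightUpDown

/-!
# `D(T)` is a down-set for a tight family twin-free on its support

The kernel lemma `isDownSet_diffs_of_tight_of_twinFree` (MSTightUpDown) takes full twin-freeness.
Addendum 52 §1 remarks that the same proof works when only the elements of the support
`∪T ∖ ∩T` are required to be twin-free (a core element or a free element of `T` is a twin of
nothing on the support, and never lies in a difference). This module records that version
(`isDownSet_diffs_of_tight_of_twinFree_support`) and the fact needed for Theorem (i): a tight
one-point extension `insert m K` of a family `K` twin-free on its support is again twin-free on
its support (`twinFree_support_insert_of_ext`) — every element of the support of `insert m K`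
lies on the support of `K`, because `m \ k` and `k \ m` are differences of `K`.
-/

namespace PercRepro.MSTight

open Finset
open scoped FinsetFamily

variable {α : Type*} [DecidableEq α] [Fintype α]

/-- The twin class of an element of the support is a singleton when the support is twin-free. -/
theorem cls_eq_singleton_of_twinFree_support {T : Finset (Finset α)}
    (htf : ∀ a b, (∃ t ∈ T, a ∈ t) → (∃ t ∈ T, a ∉ t) → Twin T a b → a = b) {a : α}
    (hin : ∃ t ∈ T, a ∈ t) (hout : ∃ t ∈ T, a ∉ t) : cls T a = {a} := by
  ext b
  rw [mem_cls, mem_singleton]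
  exact ⟨fun h => (htf a b hin hout h).symm, fun h => h ▸ twin_refl T a⟩

/-- Every element of a difference of a tight family twin-free on its support is a singleton
difference. -/
theorem singleton_mem_diffs_of_tight_of_twinFree_support {T : Finset (Finset α)} (hT : Tight T)
    (htf : ∀ a b, (∃ t ∈ T, a ∈ t) → (∃ t ∈ T, a ∉ t) → Twin T a b → a = b) {w : Finset α}
    (hw : w ∈ T \\ T) {a : α} (ha : a ∈ w) : ({a} : Finset α) ∈ T \\ T := by
  obtain ⟨t₁, ht₁, t₀, ht₀, rfl⟩ := mem_diffs.1 hw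
  rw [← cls_eq_singleton_of_twinFree_support htf ⟨t₁, ht₁, (mem_sdiff.1 ha).1⟩
    ⟨t₀, ht₀, (mem_sdiff.1 ha).2⟩]
  exact cls_mem_diffs_of_tight hT ht₁ (mem_sdiff.1 ha).1 ht₀ (mem_sdiff.1 ha).2

/-- Removing any set from a difference of a tight family twin-free on its support gives a
difference. -/
theorem sdiff_mem_diffs_of_tight_of_twinFree_support {T : Finset (Finset α)} (hT : Tight T)
    (htf : ∀ a b, (∃ t ∈ T, a ∈ t) → (∃ t ∈ T, a ∉ t) → Twin T a b → a = b) {w : Finset α}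
    (hw : w ∈ T \\ T) (S : Finset α) : w \ S ∈ T \\ T := by
  induction S using Finset.induction_on with
  | empty => simpa using hw
  | insert a S haS ih =>
    by_cases haw : a ∈ w \ S
    · have h1 : w \ insert a S = (w \ S) \ {a} := by
        ext x
        simp only [mem_sdiff, mem_insert, mem_singleton]
        tauto
      rw [h1, ← diffs_diffs_eq_of_tight hT]
      exact mem_diffs.2 ⟨w \ S, ih, {a},
        singleton_mem_diffs_of_tight_of_twinFree_support hT htf ih haw, rfl⟩
    · have h1 : w \ insert a S = w \ S := by
        ext x
        simp only [mem_sdiff, mem_insert]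
        constructor
        · rintro ⟨hx, hx'⟩
          exact ⟨hx, fun h => hx' (Or.inr h)⟩
        · rintro ⟨hx, hx'⟩
          refine ⟨hx, ?_⟩
          rintro (rfl | h)
          · exact haw (mem_sdiff.2 ⟨hx, hx'⟩)
          · exact hx' h
      rw [h1]
      exact ih

/-- **`D(T)` is a down-set for every tight `T` twin-free on its support.** -/
theorem isDownSet_diffs_of_tight_of_twinFree_support {T : Finset (Finset α)} (hT : Tight T)
    (htf : ∀ a b, (∃ t ∈ T, a ∈ t) → (∃ t ∈ T, a ∉ t) → Twin T a b → a = b) :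
    IsDownSet (T \\ T) := by
  intro w hw w' hw'
  have : w' = w \ (w \ w') := by
    ext x
    simp only [mem_sdiff]
    constructor
    · intro hx
      exact ⟨hw' hx, fun h => h.2 hx⟩
    · rintro ⟨hx, hx'⟩
      by_contra h
      exact hx' ⟨hx, h⟩
  rw [this]
  exact sdiff_mem_diffs_of_tight_of_twinFree_support hT htf hw _

omit [Fintype α] in
/-- An element of the support of a one-point extension `insert m K` (with `m \\ K` and `K \\ m`
differences of `K`) lies on the support of `K`. -/
theorem support_insert_subset_of_ext {K : Finset (Finset α)} {m : Finset α}
    (hm1 : ∀ k ∈ K, m \ k ∈ K \\ K) (hm0 : ∀ k ∈ K, k \ m ∈ K \\ K) (hne : K.Nonempty) {a : α}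
    (hin : ∃ t ∈ insert m K, a ∈ t) (hout : ∃ t ∈ insert m K, a ∉ t) :
    (∃ k ∈ K, a ∈ k) ∧ ∃ k ∈ K, a ∉ k := by
  obtain ⟨k₀, hk₀⟩ := hne
  constructor
  · obtain ⟨t, ht, hat⟩ := hin
    rcases mem_insert.1 ht with rfl | htK
    · by_cases hak : a ∈ k₀
      · exact ⟨k₀, hk₀, hak⟩
      · obtain ⟨k₁, hk₁, k₂, -, h⟩ := mem_diffs.1 (hm1 k₀ hk₀)
        have : a ∈ t \ k₀ := mem_sdiff.2 ⟨hat, hak⟩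
        rw [← h] at this
        exact ⟨k₁, hk₁, (mem_sdiff.1 this).1⟩
    · exact ⟨t, htK, hat⟩
  · obtain ⟨t, ht, hat⟩ := hout
    rcases mem_insert.1 ht with rfl | htK
    · by_cases hak : a ∈ k₀
      · obtain ⟨k₁, -, k₂, hk₂, h⟩ := mem_diffs.1 (hm0 k₀ hk₀)
        have : a ∈ k₀ \ t := mem_sdiff.2 ⟨hak, hat⟩
        rw [← h] at this
        exact ⟨k₂, hk₂, (mem_sdiff.1 this).2⟩
      · exact ⟨k₀, hk₀, hak⟩
    · exact ⟨t, htK, hat⟩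

omit [Fintype α] in
/-- A tight one-point extension of a family twin-free on its support is twin-free on its
support. -/
theorem twinFree_support_insert_of_ext {K : Finset (Finset α)} {m : Finset α}
    (hm1 : ∀ k ∈ K, m \ k ∈ K \\ K) (hm0 : ∀ k ∈ K, k \ m ∈ K \\ K) (hne : K.Nonempty)
    (hKtf : ∀ a b, (∃ k ∈ K, a ∈ k) → (∃ k ∈ K, a ∉ k) → Twin K a b → a = b) :
    ∀ a b, (∃ t ∈ insert m K, a ∈ t) → (∃ t ∈ insert m K, a ∉ t) → Twin (insert m K) a b →
      a = b := by
  intro a b hin hout hab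
  obtain ⟨hin', hout'⟩ := support_insert_subset_of_ext hm1 hm0 hne hin hout
  exact hKtf a b hin' hout' fun k hk => hab k (mem_insert_of_mem hk)

/-- **`D(insert m K)` is a down-set** for a tight one-point extension of a family twin-free on its
support. -/
theorem isDownSet_diffs_insert_of_ext {K : Finset (Finset α)} {m : Finset α}
    (hT : Tight (insert m K)) (hm1 : ∀ k ∈ K, m \ k ∈ K \\ K) (hm0 : ∀ k ∈ K, k \ m ∈ K \\ K)
    (hne : K.Nonempty)
    (hKtf : ∀ a b, (∃ k ∈ K, a ∈ k) → (∃ k ∈ K, a ∉ k) → Twin K a b → a = b) :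
    IsDownSet (insert m K \\ insert m K) :=
  isDownSet_diffs_of_tight_of_twinFree_support hT (twinFree_support_insert_of_ext hm1 hm0 hne hKtf)

end PercRepro.MSTight
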